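import Mathlib
import HarnessLib
import Summits.ResolutionOfSingularities.ResolutionOfSingularities.Theorems.WildQuotientsWildQuotientResolutionS1aKillCriterion

/-!
# S1a — THE CHAIN TYPE (KC5): a kill certificate for ANY number of centre generators each of which is, to leading order, a unit times an increment

[OURS · L1 W4.5c · lead-1 g14; generalises KILL-CRITERION v1 KC4 (`irrelevant_of_smoothTransversalType`, c = 2, weights (2,1)), KC4′
(`irrelevant_of_jordanChainThree`, c = 3, weights (3,2,1)) and F5 (`irrelevant_of_conormalType`, c = 2, weights (1,1)) to arbitrary `c` and arbitrary
positive weights] — NOT statements of the manuscript; counted 0; AI-level work, weaker than expert review. Crux stmt-ResolutionOfSingularities-17941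
`CyclicQuotientFourfolds`, line `s1a-logminvertex` v13, instance programme (`stub_reachLowerInFX`). Route-independent; pure algebra on the cobordant algebra
`R^w = B[s, fᵢ t^{wᵢ}]`.

THE CHAIN TYPE. Centre `f : Fin c → B` with weights `w` (all `> 0`), boundary element `β`. CHAIN DATA at the generator `fᵢ`: elements `uᵢ, hᵢ ∈ B` with
`hᵢ` a unit, `uᵢ ∈ 𝒥_{wᵢ − 1}` and `σ uᵢ − uᵢ − β hᵢ fᵢ ∈ β 𝒥_{wᵢ + 1}` — in words: `fᵢ` is, modulo higher weight and up to a unit, the twisted derivative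
`(σ − 1)/β` of an element ONE LEVEL UP. Then hypothesis (i) of KC3 holds with `N = 1`: in `R^w`, `σ_R (uᵢ t^{wᵢ−1}) − uᵢ t^{wᵢ−1} = β s (hᵢ fᵢʼ + s · jᵢ t^{wᵢ+1})`
(`sigmaR_sub_eq_of_admissible`), so `fᵢʼ ∈ (augIdeal σ_R : β s) ⊔ (s)` (`mem_colon_sup_excIdeal_of_unit`).
* ★★ `irrelevant_of_chains` — (i) of KC3 with `N = 1` from chain data at every generator;
* ★★ `cobordantKillCert_of_chains` — KC3 ∘ KC5: (a′) boundary-admissibility ∧ (ii) isolation ∧ chain data ⇒ the cobordant kill certificate `β s`;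
* `cobordantKillCert_of_exactChains` — EXACT chains `σ uᵢ − uᵢ = β fᵢ` (every linear unipotent `σ` in adapted coordinates, `β = 1`): isolation is then
  automatic (`fᵢ β ∈ augIdeal σ`, `N = 1`), so (a′) and the chains alone give the certificate.
Inhabitants: `J₄` (`u = (x₁, x₂, x₃)` for `f = (x₀, x₁, x₂)`, weights (3,2,1)), `J₃ ⊕ J₁` ((2,1)), `J₂ ⊕ J₂` ((1,1)), the transvection ((1)), every direct sum
of Jordan blocks in any number of variables, and the triangular germs of X-CERT v1.3-SMALLP (sm: `x₂ ↦ x₂ + x₀, x₃ ↦ x₃ + x₂`, centre (x₀:2, x₂:1)).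
-/

set_option linter.dupNamespace false

noncomputable section

open Literature.AlgebraicGeometry.Resolution
open scoped LaurentPolynomial
open LaurentPolynomial
open Summit.ResolutionOfSingularities.ResolutionOfSingularities.Theorems.WildQuotientResolution.S1.CoarseChart

namespace Summit.ResolutionOfSingularities.ResolutionOfSingularities.Theorems.WildQuotientResolution.S1.KillCert

universe u

section Chains

variable {B : Type u} [CommRing B] {c : ℕ} (f : Fin c → B) (w : Fin c → ℕ) (σ : B ≃+* B)
  (hσJ : ∀ n : ℕ, ((weightedFiltration f w).ideal n).map (σ : B →+* B) ≤ (weightedFiltration f w).ideal n)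
  {p : ℕ} (hp : 0 < p) (hσp : ∀ x : B, (⇑σ)^[p] x = x)

/-- ★★ **KC5 — THE CHAIN TYPE.** If at every centre generator `fᵢ` there are `uᵢ ∈ 𝒥_{wᵢ−1}` and a unit `hᵢ` with `σ uᵢ − uᵢ − β hᵢ fᵢ ∈ β 𝒥_{wᵢ+1}`
(`wᵢ > 0`), then the vertex ideal lies in `(augIdeal σ_R : β s) ⊔ (s)` — hypothesis (i) of KC3 with `N = 1`. For each `i`:
`σ_R (uᵢ t^{wᵢ−1}) − uᵢ t^{wᵢ−1} = β s · (hᵢ fᵢʼ + s · jᵢ t^{wᵢ+1})`. [OURS · L1 W4.5c · KC5; NOT a statement of the manuscript] -/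
theorem irrelevant_of_chains (β : B)
    (hchain : ∀ i, 0 < w i ∧ ∃ u h : B, IsUnit h ∧ u ∈ (weightedFiltration f w).ideal (w i - 1) ∧
      σ u - u - β * h * f i ∈ Ideal.span {β} * (weightedFiltration f w).ideal (w i + 1)) :
    cobordantAlgebra.vertexIdeal f w ≤
      (augmentationIdeal (sigmaR σ f w hσJ hp hσp)).colon
          (Ideal.span {algebraMap B (↥(cobordantAlgebra f w)) β * cobordantAlgebra.s f w}) ⊔
        cobordantAlgebra.excIdeal f w := by
  rw [cobordantAlgebra.vertexIdeal, Ideal.span_le]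
  rintro _ ⟨i, rfl⟩
  obtain ⟨hwi, u, h, hh, hu, hrow⟩ := hchain i
  obtain ⟨j, hj, ej⟩ := Ideal.mem_span_singleton_mul.mp hrow
  -- `w i = n + 1`
  obtain ⟨n, hn⟩ : ∃ n : ℕ, w i = n + 1 := ⟨w i - 1, (Nat.succ_pred_eq_of_pos hwi).symm⟩
  have hu' : u ∈ (weightedFiltration f w).ideal n := by rw [hn, Nat.add_sub_cancel] at hu; exact hu
  -- the leading term `J = h fᵢ + j ∈ 𝒥_{wᵢ}` of the increment of `u`
  have hJ : h * f i + j ∈ (weightedFiltration f w).ideal (n + 1) := by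
    rw [← hn]
    exact add_mem (Ideal.mul_mem_left _ _ (mem_weightedFiltration_ideal f w i)) ((weightedFiltration f w).antitone (Nat.le_succ _) hj)
  have hyj : σ u - u = β * (h * f i + j) := by
    rw [mul_add, ej]
    ring
  -- the players in `R^w`
  let z : ↥(cobordantAlgebra f w) := ⟨_, C_mul_T_mem_cobordantAlgebra f w hu'⟩
  let zj : ↥(cobordantAlgebra f w) := ⟨_, C_mul_T_mem_cobordantAlgebra f w hj⟩
  have hzj : ((zj : ↥(cobordantAlgebra f w)) : B[T;T⁻¹]) = C j * T ((w i + 1 : ℕ) : ℤ) := rfl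
  have hz' : ((algebraMap B (↥(cobordantAlgebra f w)) h * cobordantAlgebra.u' f w i + cobordantAlgebra.s f w * zj :
      ↥(cobordantAlgebra f w)) : B[T;T⁻¹]) = C (h * f i + j) * T ((n + 1 : ℕ) : ℤ) := by
    rw [AddMemClass.coe_add, MulMemClass.coe_mul, MulMemClass.coe_mul, cobordantAlgebra.coe_algebraMap, cobordantAlgebra.coe_u',
      cobordantAlgebra.coe_s, hzj, hn, map_add, map_mul, add_mul]
    congr 1
    · rw [mul_assoc]
    · rw [mul_left_comm, ← T_add]
      congr 2
      push_cast
      ring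
  have key : (algebraMap B (↥(cobordantAlgebra f w)) h * cobordantAlgebra.u' f w i + cobordantAlgebra.s f w * zj) *
      (algebraMap B (↥(cobordantAlgebra f w)) β * cobordantAlgebra.s f w) = sigmaR σ f w hσJ hp hσp z - z := by
    rw [mul_comm, sigmaR_sub_eq_of_admissible f w σ hσJ hp hσp β hyj z _ rfl hz']
  refine mem_colon_sup_excIdeal_of_unit f w (hh.map (algebraMap B (↥(cobordantAlgebra f w)))) (z := zj) ?_
  rw [key]
  exact sub_mem_augmentationIdeal _ _

/-- ★★ **KC3 ∘ KC5: the chain type kills.** Boundary-admissibility (a′) with `δ = 1`, isolation (ii), and chain data at every centre generator give the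
cobordant kill certificate `β s` — hence (KC1) the augmentation ideal of `σʼ` is `(β s)` on EVERY σ-fixed chart of the weighted cobordant blow-up of
`(f, w)`, any number of generators, any positive weights. [OURS · L1 W4.5c · KC3∘KC5; NOT a statement of the manuscript] -/
theorem cobordantKillCert_of_chains (β : B)
    (hadm : ∀ (n : ℕ) (y : B), y ∈ (weightedFiltration f w).ideal n →
      σ y - y ∈ Ideal.span {β} * (weightedFiltration f w).ideal (n + 1))
    (hiso : ∃ N : ℕ, Ideal.span (Set.range f) ^ N ≤ (augmentationIdeal σ).colon (Ideal.span {β}))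
    (hchain : ∀ i, 0 < w i ∧ ∃ u h : B, IsUnit h ∧ u ∈ (weightedFiltration f w).ideal (w i - 1) ∧
      σ u - u - β * h * f i ∈ Ideal.span {β} * (weightedFiltration f w).ideal (w i + 1)) :
    CobordantKillCert f w σ hσJ hp hσp (algebraMap B (↥(cobordantAlgebra f w)) β * cobordantAlgebra.s f w) :=
  cobordantKillCert_of_admissible_of_irrelevant f w σ hσJ hp hσp β hadm hiso
    ⟨1, by rw [pow_one]; exact irrelevant_of_chains f w σ hσJ hp hσp β hchain⟩

/-- **EXACT chains make isolation automatic**: if `σ uᵢ − uᵢ = β hᵢ fᵢ` with `hᵢ` a unit for every `i`, then `fᵢ β ∈ augIdeal σ`, so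
`(f) ≤ (augIdeal σ : β)`. [OURS · L1 W4.5c] -/
theorem span_range_le_colon_of_exactChains (β : B)
    (hexact : ∀ i, ∃ u h : B, IsUnit h ∧ σ u - u = β * h * f i) :
    Ideal.span (Set.range f) ≤ (augmentationIdeal σ).colon (Ideal.span {β}) := by
  rw [Ideal.span_le]
  rintro _ ⟨i, rfl⟩
  obtain ⟨u, h, hh, hu⟩ := hexact i
  obtain ⟨v, rfl⟩ := hh
  rw [SetLike.mem_coe, Ideal.mem_colon_span_singleton]
  have hmem : β * ↑v * f i ∈ augmentationIdeal σ := by rw [← hu]; exact sub_mem_augmentationIdeal σ u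
  have e1 : f i * β = ↑v⁻¹ * (β * ↑v * f i) := by
    rw [← mul_assoc, ← mul_assoc, mul_comm (↑v⁻¹ : B) β, mul_assoc β, Units.inv_mul, mul_one, mul_comm]
  rw [e1]
  exact Ideal.mul_mem_left _ _ hmem

/-- ★★ **KC3 ∘ KC5, exact form.** With EXACT chains `σ uᵢ − uᵢ = β hᵢ fᵢ` (`uᵢ ∈ 𝒥_{wᵢ−1}`, `hᵢ` units, `wᵢ > 0`) the boundary-admissibility (a′) alone
gives the cobordant kill certificate `β s`. Every LINEAR unipotent automorphism in coordinates adapted to the image flag of `σ − 1` is of this form with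
`β = 1`, `hᵢ = 1` (centre = the adapted basis of `im (σ − 1)`, weight = depth in the flag, `uᵢ` = a preimage one level up).
[OURS · L1 W4.5c · KC3∘KC5; NOT a statement of the manuscript] -/
theorem cobordantKillCert_of_exactChains (β : B)
    (hadm : ∀ (n : ℕ) (y : B), y ∈ (weightedFiltration f w).ideal n →
      σ y - y ∈ Ideal.span {β} * (weightedFiltration f w).ideal (n + 1))
    (hexact : ∀ i, 0 < w i ∧ ∃ u h : B, IsUnit h ∧ u ∈ (weightedFiltration f w).ideal (w i - 1) ∧ σ u - u = β * h * f i) :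
    CobordantKillCert f w σ hσJ hp hσp (algebraMap B (↥(cobordantAlgebra f w)) β * cobordantAlgebra.s f w) := by
  refine cobordantKillCert_of_chains f w σ hσJ hp hσp β hadm ⟨1, ?_⟩ fun i => ?_
  · rw [pow_one]
    exact span_range_le_colon_of_exactChains f σ β fun i => (hexact i).2.imp fun u ⟨h, hh, _, hu⟩ => ⟨h, hh, hu⟩
  · obtain ⟨hwi, u, h, hh, hu, hrow⟩ := hexact i
    exact ⟨hwi, u, h, hh, hu, by rw [hrow, sub_self]; exact Ideal.zero_mem _⟩

end Chains

end Summit.ResolutionOfSingularities.ResolutionOfSingularities.Theorems.WildQuotientResolution.S1.KillCert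

end
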